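import Literature.NumberTheory.EllipticCurves.CriticalSlopePAdicLFunction
import Literature.NumberTheory.EllipticCurves.PAdicGrossZagierConstantTermProofs
import HarnessLib

/-!
# `L_p(f_β, 0) = 0` when `L(E, 1) = 0`: the critical-slope `p`-adic `L`-function vanishes at `T = 0`
# in positive analytic rank (proofs over `CriticalSlopePAdicLFunction`)

For the β-road cruxes of route `SlopeDichotomyA2` (`BetaGrossZagierA2`, `BetaLeadingTermA2`: rank-one
pairs, leading term of `L_p(f_β, T)` at `T = 0`): the constant term of the critical-slope `p`-adic
`L`-function of the newform `f` of `W` is `(1 − β⁻¹)² [0]⁺_f`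
(`constantCoeff_criticalSlopePAdicLFunction_of_isEigenLift`, Mazur–Tate–Teitelbaum §I.14 (14.3) at the
trivial character / Pollack–Stevens Prop. 6.5), and `[0]⁺_f = L(f,1)/Ω⁺_f = 0` when `L(W, 1) = 0`
(`ratPlusSymbol_zero_eq_zero_of_entireLFunction_eq_zero`, MTT §I.8 (8.6)); hence `T ∣ L_p(f_β, T)`
whenever `L(W, 1) = 0`, in particular whenever `ord_{s=1} L(W, s) ≠ 0` (e.g. analytic rank one).
No named facts; proofs only.

## References

* B. Mazur, J. Tate, J. Teitelbaum, *On p-adic analogues of the conjectures of Birch and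
  Swinnerton-Dyer*, Invent. Math. 84 (1986), §I.8 (8.6), §I.14 (14.3). [MazurTateTeitelbaum1986Invent]
* R. Pollack, G. Stevens, *Overconvergent modular symbols and p-adic L-functions* (2011), Prop. 6.5
  (p. 31). [PollackStevens2011]
-/

noncomputable section

open scoped MatrixGroups ModularForm
open CongruenceSubgroup PowerSeries Literature.NumberTheory.EllipticCurves.ModularForms

namespace Literature.NumberTheory.EllipticCurves.OMSWeightTwo

variable {p : ℕ} [Fact p.Prime] {W : WeierstrassCurve ℚ} [W.IsGloballyMinimal] [W.IsElliptic]
  {N : ℕ} [NeZero N] {f : CuspForm (Gamma0 N) 2} {β : ℚ_[p]} {Φ : OMSymb p (N * p)}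

/-- **`L(E, 1) = 0 ⇒ L_p(f_β, 0) = 0`.**  For the newform `f` of `W` (`p ∤ N`, `β ≠ 0` a root of
`X² − a_p X + p`) and an eigen-lift `Φ` of `φ_β`: if `L(W, 1) = 0` then the constant term of
`L_p(Φ, β; T)` vanishes, since it is `(1 − β⁻¹)² [0]⁺_f` and `[0]⁺_f = L(f,1)/Ω⁺_f`.
[cite: MazurTateTeitelbaum1986Invent, §I.14 (14.3) and §I.8 (8.6)] [cite: PollackStevens2011, Prop. 6.5 (p. 31)] -/
theorem constantCoeff_criticalSlopePAdicLFunction_eq_zero_of_entireLFunction_eq_zero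
    (hf : IsNewformOf W f) (hpN : ¬ p ∣ N) (hβ0 : β ≠ 0)
    (hβ : β ^ 2 - (W.LFunction p : ℚ_[p]) * β + p = 0) (hΦ : IsEigenLift W f β Φ)
    (hL : W.entireLFunction 1 = 0) :
    constantCoeff (criticalSlopePAdicLFunction Φ β) = 0 := by
  rw [constantCoeff_criticalSlopePAdicLFunction_of_isEigenLift hf hpN hβ0 hβ hΦ,
    ratPlusSymbol_zero_eq_zero_of_entireLFunction_eq_zero hf hL, Rat.cast_zero, mul_zero]

/-- **`T ∣ L_p(f_β, T)` when `L(E, 1) = 0`.** [cite: MazurTateTeitelbaum1986Invent, §I.14 (14.3)]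
[cite: PollackStevens2011, Prop. 6.5 (p. 31)] -/
theorem X_dvd_criticalSlopePAdicLFunction_of_entireLFunction_eq_zero
    (hf : IsNewformOf W f) (hpN : ¬ p ∣ N) (hβ0 : β ≠ 0)
    (hβ : β ^ 2 - (W.LFunction p : ℚ_[p]) * β + p = 0) (hΦ : IsEigenLift W f β Φ)
    (hL : W.entireLFunction 1 = 0) :
    (X : PowerSeries ℚ_[p]) ∣ criticalSlopePAdicLFunction Φ β :=
  PowerSeries.X_dvd_iff.mpr
    (constantCoeff_criticalSlopePAdicLFunction_eq_zero_of_entireLFunction_eq_zero hf hpN hβ0 hβ hΦ hL)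

/-- **`T ∣ L_p(f_β, T)` in positive analytic rank** (`ord_{s=1} L(W, s) ≠ 0 ⇒ L(W, 1) = 0`).
[cite: MazurTateTeitelbaum1986Invent, §I.14 (14.3)] [cite: PollackStevens2011, Prop. 6.5 (p. 31)] -/
theorem X_dvd_criticalSlopePAdicLFunction_of_analyticRank_ne_zero
    (hf : IsNewformOf W f) (hpN : ¬ p ∣ N) (hβ0 : β ≠ 0)
    (hβ : β ^ 2 - (W.LFunction p : ℚ_[p]) * β + p = 0) (hΦ : IsEigenLift W f β Φ)
    (hr : W.analyticRank ≠ 0) :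
    (X : PowerSeries ℚ_[p]) ∣ criticalSlopePAdicLFunction Φ β :=
  X_dvd_criticalSlopePAdicLFunction_of_entireLFunction_eq_zero hf hpN hβ0 hβ hΦ
    (apply_eq_zero_of_analyticOrderNatAt_ne_zero (f := W.entireLFunction) hr)

/-- The same for `L_p(f_β, T) = criticalSlopePAdicLFunctionOf W f β` under non-`θ`-criticality.
[cite: MazurTateTeitelbaum1986Invent, §I.14 (14.3)] [cite: PollackStevens2011, Prop. 6.5 and Def. 6.4 (p. 31)] -/
theorem X_dvd_criticalSlopePAdicLFunctionOf_of_entireLFunction_eq_zero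
    (hf : IsNewformOf W f) (hpN : ¬ p ∣ N) (hβ0 : β ≠ 0)
    (hβ : β ^ 2 - (W.LFunction p : ℚ_[p]) * β + p = 0) (hθ : SpecializeInjOnEigenspace W N β)
    (hΦ : IsEigenLift W f β Φ) (hL : W.entireLFunction 1 = 0) :
    (X : PowerSeries ℚ_[p]) ∣ criticalSlopePAdicLFunctionOf W f β := by
  rw [criticalSlopePAdicLFunctionOf_eq hθ hΦ]
  exact X_dvd_criticalSlopePAdicLFunction_of_entireLFunction_eq_zero hf hpN hβ0 hβ hΦ hL

/-- **Conversely, in analytic rank zero the constant term is `(1 − β⁻¹)²·[0]⁺_f` with `(1 − β⁻¹)² ≠ 0`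
for the critical-slope root** (`v_p(β) = 1` forces `β ≠ 1`): `L_p(f_β, 0) = 0 ↔ [0]⁺_f = 0`.
[cite: MazurTateTeitelbaum1986Invent, §I.14 (14.3)] [cite: PollackStevens2011, Prop. 6.5 (p. 31)] -/
theorem constantCoeff_criticalSlopePAdicLFunction_eq_zero_iff
    (hf : IsNewformOf W f) (hpN : ¬ p ∣ N) (hβv : Padic.valuation β = 1)
    (hβ : β ^ 2 - (W.LFunction p : ℚ_[p]) * β + p = 0) (hΦ : IsEigenLift W f β Φ) :
    constantCoeff (criticalSlopePAdicLFunction Φ β) = 0 ↔ ratPlusSymbol f 0 = 0 := by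
  have hβ0 : β ≠ 0 := by
    intro h
    rw [h, Padic.valuation_zero] at hβv
    exact zero_ne_one hβv
  have hβ1 : β ≠ 1 := by
    intro h
    rw [h, Padic.valuation_one] at hβv
    exact zero_ne_one hβv
  have hfac : (1 - β⁻¹) ^ 2 ≠ 0 := pow_ne_zero _ (sub_ne_zero.mpr (fun h => hβ1 (by
    rw [eq_comm, inv_eq_one] at h; exact h)))
  rw [constantCoeff_criticalSlopePAdicLFunction_of_isEigenLift hf hpN hβ0 hβ hΦ, mul_eq_zero,
    or_iff_right hfac, Rat.cast_eq_zero]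

end Literature.NumberTheory.EllipticCurves.OMSWeightTwo

end
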